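import Summits.PneNP.PneNP.Theorems.OneSliceConstantBandOfEngine
import Summits.PneNP.PneNP.Theorems.OneSliceBandImpliesThreshold

/-!
# Route OneSlice, crux `ConstantBand` (stmt-PneNP-2834), line `flat-prior-relative-minterms`:
# every sufficient engine of the line implies Rossman's single-threshold problem

The line `flat-prior-relative-minterms` reduces the crux `Summit.PneNP.PneNP.Theses.OneSlice.ConstantBand` to ONE open
engine, recorded in the tree in three forms of increasing strength — `BandPair` (transfer target), `AdvSparse`
(distinguishing form), `RelMintermSparse` (the registered stub S4) — each of which closes the crux through LANDED theorems
(`fprm_constantBand_of_bandPair`, `fprm_constantBand_of_advSparse`, `fprm_constantBand_of_relMintermSparse`).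

This file is the kernel-checked HARDNESS CERTIFICATE of that residual stub (lead c2, 2026-08-16): composing with the
landed bridge `Summit.PneNP.PneNP.Theorems.bandImpliesThreshold_proof : ConstantBand → SingleThreshold` (route item
stmt-PneNP-2839, proved), each of the three engine statements implies `Summit.PneNP.PneNP.Theses.OneSlice.SingleThreshold`
— route crux #2 (stmt-PneNP-2833), Rossman's open single-threshold problem (FOCS 2010 §9) in unbounded-exponent form. So no
proof of S4 (in any of its three forms) exists short of a solution of that problem; the line is complete modulo S4 and S4
is crux-sized. CONDITIONAL compositions (D-0014): hypotheses are open statements of the line, not Literature facts; they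
close nothing by themselves.
-/

set_option linter.dupNamespace false

namespace Summit.PneNP.PneNP.Cruxes.ConstantBand.FlatPriorRelativeMinterms

open Summit.PneNP.PneNP.Theses.OneSlice (ConstantBand SingleThreshold)

/-- **The transfer target is at least the single-threshold problem**: `BandPair → SingleThreshold`, through the
landed transfer `stub_transferStep : SliceLemma23 → BandPair → ConstantBandSchedule` (S5), the landed slice Lemma 23
`stub_sliceLemma23` (S1), the disprover's `Iff.rfl` bridge `constantBand_iff`, and `bandImpliesThreshold_proof`
(item 2839, landed) — the same one-liner as `fprm_constantBand_of_bandPair` (`OneSliceConstantBandOfBandPair.lean`),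
inlined so that this file does not depend on that module. -/
theorem fprm_singleThreshold_of_bandPair : BandPair → SingleThreshold :=
  fun hB => Summit.PneNP.PneNP.Theorems.bandImpliesThreshold_proof
    (constantBand_iff.2 (stub_transferStep stub_sliceLemma23 hB))

/-- **The distinguishing form is at least the single-threshold problem**: `AdvSparse → SingleThreshold` ("an FPT
average-case planted-`k`-clique distinguisher lower bound on the critical lower band gives Rossman's single threshold"). -/
theorem fprm_singleThreshold_of_advSparse : AdvSparse → SingleThreshold :=
  fun hA => Summit.PneNP.PneNP.Theorems.bandImpliesThreshold_proof (fprm_constantBand_of_advSparse hA)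

/-- **The registered stub S4 is at least the single-threshold problem**: `RelMintermSparse → SingleThreshold`, through
all four landed stubs of the line (`fprm_constantBand_of_relMintermSparse`) and `bandImpliesThreshold_proof`. -/
theorem fprm_singleThreshold_of_relMintermSparse : RelMintermSparse → SingleThreshold :=
  fun hS => Summit.PneNP.PneNP.Theorems.bandImpliesThreshold_proof (fprm_constantBand_of_relMintermSparse hS)

end Summit.PneNP.PneNP.Cruxes.ConstantBand.FlatPriorRelativeMinterms
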